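import Literature.Analysis.ODE.KernelPairing
import Literature.Analysis.ODE.BarrierProductBound
import Literature.Analysis.ODE.SoninEnvelope
import Literature.Analysis.ODE.DiagonalKernelMaximum
import HarnessLib

/-!
# Two-point Green-kernel bound from one-sided envelopes (flux regime, single barrier)

Topic `Literature/Analysis/ODE` (namespace `Literature.Analysis.ODE`). Let `u, v` be complex
solutions on `ℝ` of the real equation `y″ = −φ y` with CONSTANT fluxes of the same sign,
`Im(ū u′) ≡ −σ`, `Im(v̄ v′) ≡ ω`, `ωσ > 0` (the horizon- and infinity-normalised solutions of a radial
wave equation at a non-superradiant, non-threshold frequency). Their Wronskian `W = u v′ − v u′` is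
constant and `‖W‖ ≥ 2√(ωσ)`; the pairing `|ω|‖u‖² + |σ|‖v‖² ≤ ‖u‖‖v‖‖W‖` controls each solution by
the other one pointwise (`KernelPairing.lean`, sign-symmetrised here). Consequently the two-point
kernel `u(x)v(x′)` (`x ≤ x′`) is bounded by `poly × ‖W‖` as soon as ONE-SIDED envelopes are known:

* `kernel_le_of_envelope_right` — NO BARRIER NEEDED: if `‖v‖ ≤ P` everywhere, then
  `‖u x‖‖v x′‖ ≤ (P²/|ω|)‖W‖` for all `x, x′`;
* `kernel_le_of_envelopes_barrier` — SINGLE BARRIER `[b₁, b₂]` (`φ ≤ 0` there): if `‖u‖ ≤ P_u` on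
  `(−∞, b₁]` and `‖v‖ ≤ P_v` on `[b₂, ∞)`, then for all `x ≤ x′`
  `‖u x‖‖v x′‖ ≤ ‖W‖·(3P_u²/|σ| + 3P_v²/|ω| + 3P_uP_v/(2√(ωσ)) + 2(b₂ − b₁))`
  (pairs on one side: pairing; across: Wronskian floor; one point inside: convexity of `‖·‖²` on the
  barrier (`SoninEnvelope.norm_sq_le_max_of_nonneg`) and pairing at the barrier ends; both inside:
  `BarrierProductBound.barrier_product_bound` with `A = ‖W‖²/σ²`, `B = ‖W‖²/ω²`).

No asymptotic analysis enters; the envelopes `P_u, P_v` carry all the quantitative information.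
Used by the flux-regime cone kernel bound of the near-extremal Kerr programme.

## References
* I. M. Gelfand, L. A. Dikii, Russian Math. Surveys 30:5 (1975) (diagonal resolvent kernel).
* M. Dafermos, I. Rodnianski, Y. Shlapentokh-Rothman, arXiv:1402.7034, §7.2 (fluxes of the
  normalised pair); R. Teixeira da Costa, CMP 378 (2020), Prop. 2.20. The assembly is folklore.
-/

noncomputable section

open Set
open scoped ComplexConjugate

namespace Literature.Analysis.ODE

section Signed

/-! ### Sign-symmetric pairing consequences (`ωσ > 0`) -/

variable {u u' v v' : ℂ} {σ ω : ℝ}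

/-- `|ω|‖u‖ ≤ ‖v‖·‖W‖` for same-sign fluxes `Im(ū u′) = −σ`, `Im(v̄ v′) = ω`, `ωσ > 0`
(for `ω, σ < 0` apply the positive case to the swapped pair `(v, u)`). [folklore] -/
theorem abs_mul_norm_le_of_pairing_left (hu : (conj u * u').im = -σ) (hv : (conj v * v').im = ω)
    (h : 0 < ω * σ) : |ω| * ‖u‖ ≤ ‖v‖ * ‖u * v' - v * u'‖ := by
  rcases lt_or_gt_of_ne (show σ ≠ 0 from fun e ↦ by simp [e] at h) with hσ | hσ
  · have hω : ω < 0 := by nlinarith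
    -- swapped pair `(v, u)` with `σ' = −ω > 0`, `ω' = −σ > 0`
    have hv' : (conj v * v').im = -(-ω) := by rw [hv]; ring
    have hu' : (conj u * u').im = -σ := hu
    have key := mul_norm_le_of_pairing_right (σ := -ω) (ω := -σ) hv' hu' (by linarith)
    rw [abs_of_neg hω]
    calc -ω * ‖u‖ ≤ ‖v‖ * ‖v * u' - u * v'‖ := key
      _ = ‖v‖ * ‖u * v' - v * u'‖ := by rw [← norm_neg (v * u' - u * v'), neg_sub]
  · have hω : 0 < ω := by nlinarith
    rw [abs_of_pos hω]
    exact mul_norm_le_of_pairing_left hu hv hσ.le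

/-- `|σ|‖v‖ ≤ ‖u‖·‖W‖` for same-sign fluxes. [folklore] -/
theorem abs_mul_norm_le_of_pairing_right (hu : (conj u * u').im = -σ) (hv : (conj v * v').im = ω)
    (h : 0 < ω * σ) : |σ| * ‖v‖ ≤ ‖u‖ * ‖u * v' - v * u'‖ := by
  rcases lt_or_gt_of_ne (show σ ≠ 0 from fun e ↦ by simp [e] at h) with hσ | hσ
  · have hω : ω < 0 := by nlinarith
    have hv' : (conj v * v').im = -(-ω) := by rw [hv]; ring
    have key := mul_norm_le_of_pairing_left (σ := -ω) (ω := -σ) hv' hu (by linarith)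
    rw [abs_of_neg hσ]
    calc -σ * ‖v‖ ≤ ‖u‖ * ‖v * u' - u * v'‖ := key
      _ = ‖u‖ * ‖u * v' - v * u'‖ := by rw [← norm_neg (v * u' - u * v'), neg_sub]
  · have hω : 0 < ω := by nlinarith
    rw [abs_of_pos hσ]
    exact mul_norm_le_of_pairing_right hu hv hω.le

/-- `2√(ωσ) ≤ ‖W‖` for same-sign non-zero fluxes. [folklore] -/
theorem two_mul_sqrt_le_norm_wronskian' (hu : (conj u * u').im = -σ) (hv : (conj v * v').im = ω)
    (h : 0 < ω * σ) : 2 * Real.sqrt (ω * σ) ≤ ‖u * v' - v * u'‖ := by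
  rcases lt_or_gt_of_ne (show σ ≠ 0 from fun e ↦ by simp [e] at h) with hσ | hσ
  · have hω : ω < 0 := by nlinarith
    have hv' : (conj v * v').im = -(-ω) := by rw [hv]; ring
    have key := two_mul_sqrt_le_norm_wronskian (σ := -ω) (ω := -σ) hv' hu (by linarith) (by linarith)
    rw [show -σ * -ω = ω * σ by ring] at key
    calc 2 * Real.sqrt (ω * σ) ≤ ‖v * u' - u * v'‖ := key
      _ = ‖u * v' - v * u'‖ := by rw [← norm_neg (v * u' - u * v'), neg_sub]
  · have hω : 0 < ω := by nlinarith
    exact two_mul_sqrt_le_norm_wronskian hu hv hσ hω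

/-- Squared pairing, sign-symmetric: `‖v‖² ≤ (‖W‖²/σ²)‖u‖²`. [folklore] -/
theorem norm_sq_le_of_pairing_right' (hu : (conj u * u').im = -σ) (hv : (conj v * v').im = ω)
    (h : 0 < ω * σ) : ‖v‖ ^ 2 ≤ ‖u * v' - v * u'‖ ^ 2 / σ ^ 2 * ‖u‖ ^ 2 := by
  have hσ : σ ≠ 0 := fun e ↦ by simp [e] at h
  have h1 := abs_mul_norm_le_of_pairing_right hu hv h
  have h2 : (|σ| * ‖v‖) ^ 2 ≤ (‖u‖ * ‖u * v' - v * u'‖) ^ 2 := pow_le_pow_left₀ (by positivity) h1 2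
  rw [mul_pow, sq_abs] at h2
  rw [div_mul_eq_mul_div, le_div_iff₀ (by positivity)]
  nlinarith

/-- Squared pairing, sign-symmetric: `‖u‖² ≤ (‖W‖²/ω²)‖v‖²`. [folklore] -/
theorem norm_sq_le_of_pairing_left' (hu : (conj u * u').im = -σ) (hv : (conj v * v').im = ω)
    (h : 0 < ω * σ) : ‖u‖ ^ 2 ≤ ‖u * v' - v * u'‖ ^ 2 / ω ^ 2 * ‖v‖ ^ 2 := by
  have hω : ω ≠ 0 := fun e ↦ by simp [e] at h
  have h1 := abs_mul_norm_le_of_pairing_left hu hv h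
  have h2 : (|ω| * ‖u‖) ^ 2 ≤ (‖v‖ * ‖u * v' - v * u'‖) ^ 2 := pow_le_pow_left₀ (by positivity) h1 2
  rw [mul_pow, sq_abs] at h2
  rw [div_mul_eq_mul_div, le_div_iff₀ (by positivity)]
  nlinarith

end Signed

section TwoPoint

variable {u u' v v' : ℝ → ℂ} {φ : ℝ → ℝ} {σ ω : ℝ}

/-- The Wronskian of two global solutions of `y″ = −φ y` is the same at any two points. [folklore] -/
theorem wronskian_eq_of_global (hu : ∀ x, HasDerivAt u (u' x) x ∧ HasDerivAt u' (-((φ x : ℂ) * u x)) x)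
    (hv : ∀ x, HasDerivAt v (v' x) x ∧ HasDerivAt v' (-((φ x : ℂ) * v x)) x) (s t : ℝ) :
    u s * v' s - v s * u' s = u t * v' t - v t * u' t := by
  have key : ∀ {α x : ℝ}, α ≤ x → u x * v' x - v x * u' x = u α * v' α - v α * u' α := by
    intro α x hαx
    refine wronskian_complex_const (q := fun y ↦ -φ y) (β := x) (fun y _ ↦ ⟨(hu y).1, ?_⟩)
      (fun y _ ↦ ⟨(hv y).1, ?_⟩) (right_mem_Icc.2 hαx)
    · simpa only [Complex.ofReal_neg, neg_mul] using (hu y).2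
    · simpa only [Complex.ofReal_neg, neg_mul] using (hv y).2
  rcases le_total s t with h | h
  · exact (key h).symm
  · exact key h

/-- **Kernel bound from a global envelope of `v` (no barrier needed).** If `‖v s‖ ≤ P` for all `s`,
then `‖u x‖‖v x′‖ ≤ (P²/|ω|)‖W(x)‖` for all `x, x′` (pairing `|ω|‖u x‖ ≤ ‖v x‖‖W‖`; only the
constant fluxes are used, not even the equation). [folklore] -/
theorem kernel_le_of_envelope_right
    (hfu : ∀ s, (conj (u s) * u' s).im = -σ) (hfv : ∀ s, (conj (v s) * v' s).im = ω)
    (h : 0 < ω * σ) {P : ℝ} (hP : ∀ s, ‖v s‖ ≤ P) (x x' : ℝ) :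
    ‖u x‖ * ‖v x'‖ ≤ P ^ 2 / |ω| * ‖u x * v' x - v x * u' x‖ := by
  have hω : ω ≠ 0 := fun e ↦ by simp [e] at h
  have hω' : 0 < |ω| := abs_pos.2 hω
  have hP0 : 0 ≤ P := (norm_nonneg _).trans (hP x)
  have h1 := abs_mul_norm_le_of_pairing_left (hfu x) (hfv x) h
  -- `|ω|‖u x‖‖v x'‖ ≤ ‖v x‖‖v x'‖‖W‖ ≤ P²‖W‖`
  have h2 : |ω| * (‖u x‖ * ‖v x'‖) ≤ P ^ 2 * ‖u x * v' x - v x * u' x‖ := by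
    calc |ω| * (‖u x‖ * ‖v x'‖) = (|ω| * ‖u x‖) * ‖v x'‖ := by ring
      _ ≤ (‖v x‖ * ‖u x * v' x - v x * u' x‖) * ‖v x'‖ :=
          mul_le_mul_of_nonneg_right h1 (norm_nonneg _)
      _ = (‖v x‖ * ‖v x'‖) * ‖u x * v' x - v x * u' x‖ := by ring
      _ ≤ (P * P) * ‖u x * v' x - v x * u' x‖ := by
          apply mul_le_mul_of_nonneg_right _ (norm_nonneg _)
          exact mul_le_mul (hP x) (hP x') (norm_nonneg _) hP0
      _ = P ^ 2 * ‖u x * v' x - v x * u' x‖ := by ring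
  rw [div_mul_eq_mul_div, le_div_iff₀ hω']
  linarith

/-- **Two-point kernel bound from one-sided envelopes across a single barrier.** Let `u, v` solve
`y″ = −φy` on `ℝ` with constant same-sign fluxes `Im(ūu′) ≡ −σ`, `Im(v̄v′) ≡ ω`, `ωσ > 0`; let
`b₁ ≤ b₂` with `φ ≤ 0` on `[b₁, b₂]`, `‖u s‖ ≤ P_u` for `s ≤ b₁` and `‖v s‖ ≤ P_v` for `s ≥ b₂`. Then for
all `x ≤ x′`:
`‖u x‖‖v x′‖ ≤ ‖W‖·(3P_u²/|σ| + 3P_v²/|ω| + 3P_uP_v/(2√(ωσ)) + 2(b₂ − b₁))`. [folklore] -/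
theorem kernel_le_of_envelopes_barrier
    (hu : ∀ x, HasDerivAt u (u' x) x ∧ HasDerivAt u' (-((φ x : ℂ) * u x)) x)
    (hv : ∀ x, HasDerivAt v (v' x) x ∧ HasDerivAt v' (-((φ x : ℂ) * v x)) x)
    (hfu : ∀ s, (conj (u s) * u' s).im = -σ) (hfv : ∀ s, (conj (v s) * v' s).im = ω)
    (h : 0 < ω * σ) {b₁ b₂ Pu Pv : ℝ} (hb : b₁ ≤ b₂) (hφ : ∀ s ∈ Icc b₁ b₂, φ s ≤ 0)
    (hPu : ∀ s, s ≤ b₁ → ‖u s‖ ≤ Pu) (hPv : ∀ s, b₂ ≤ s → ‖v s‖ ≤ Pv) {x x' : ℝ} (hxx' : x ≤ x') :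
    ‖u x‖ * ‖v x'‖ ≤ ‖u x * v' x - v x * u' x‖ *
      (3 * Pu ^ 2 / |σ| + 3 * Pv ^ 2 / |ω| + 3 * (Pu * Pv) / (2 * Real.sqrt (ω * σ)) +
        2 * (b₂ - b₁)) := by
  have hω : ω ≠ 0 := fun e ↦ by simp [e] at h
  have hσ : σ ≠ 0 := fun e ↦ by simp [e] at h
  have hω' : 0 < |ω| := abs_pos.2 hω
  have hσ' : 0 < |σ| := abs_pos.2 hσ
  have hPu0 : 0 ≤ Pu := (norm_nonneg _).trans (hPu b₁ le_rfl)
  have hPv0 : 0 ≤ Pv := (norm_nonneg _).trans (hPv b₂ le_rfl)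
  -- the Wronskian is a constant `Wc`
  set Wc := u x * v' x - v x * u' x with hWc
  have hWs : ∀ s, u s * v' s - v s * u' s = Wc := fun s ↦ wronskian_eq_of_global hu hv s x
  set W := ‖Wc‖ with hWdef
  have hW0 : 0 ≤ W := norm_nonneg _
  have hfloor : 2 * Real.sqrt (ω * σ) ≤ W := by
    have := two_mul_sqrt_le_norm_wronskian' (hfu x) (hfv x) h; rwa [← hWc] at this
  have hsq : 0 < Real.sqrt (ω * σ) := Real.sqrt_pos.2 h
  -- pointwise pairing consequences, all with the constant `W`
  have pl : ∀ s, |ω| * ‖u s‖ ≤ ‖v s‖ * W := fun s ↦ by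
    have := abs_mul_norm_le_of_pairing_left (hfu s) (hfv s) h; rwa [hWs s] at this
  have pr : ∀ s, |σ| * ‖v s‖ ≤ ‖u s‖ * W := fun s ↦ by
    have := abs_mul_norm_le_of_pairing_right (hfu s) (hfv s) h; rwa [hWs s] at this
  -- convexity of `‖u‖²`, `‖v‖²` on the barrier (equation `y″ = (−φ) y`, `−φ ≥ 0`)
  have hu' : ∀ s ∈ Icc b₁ b₂, HasDerivAt u (u' s) s ∧ HasDerivAt u' (((-φ s : ℝ) : ℂ) * u s) s :=
    fun s _ ↦ ⟨(hu s).1, by simpa only [Complex.ofReal_neg, neg_mul] using (hu s).2⟩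
  have hv' : ∀ s ∈ Icc b₁ b₂, HasDerivAt v (v' s) s ∧ HasDerivAt v' (((-φ s : ℝ) : ℂ) * v s) s :=
    fun s _ ↦ ⟨(hv s).1, by simpa only [Complex.ofReal_neg, neg_mul] using (hv s).2⟩
  have hq : ∀ s ∈ Icc b₁ b₂, 0 ≤ -φ s := fun s hs ↦ by linarith [hφ s hs]
  -- end values
  have hub : ‖u b₁‖ ≤ Pu := hPu b₁ le_rfl
  have hvb : ‖v b₂‖ ≤ Pv := hPv b₂ le_rfl
  -- `‖v b₁‖ ≤ Pu W/|σ|`, `‖u b₂‖ ≤ Pv W/|ω|`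
  have hvb₁ : ‖v b₁‖ ≤ Pu * W / |σ| := by
    rw [le_div_iff₀ hσ']
    calc ‖v b₁‖ * |σ| = |σ| * ‖v b₁‖ := mul_comm _ _
      _ ≤ ‖u b₁‖ * W := pr b₁
      _ ≤ Pu * W := mul_le_mul_of_nonneg_right hub hW0
  have hub₂ : ‖u b₂‖ ≤ Pv * W / |ω| := by
    rw [le_div_iff₀ hω']
    calc ‖u b₂‖ * |ω| = |ω| * ‖u b₂‖ := mul_comm _ _
      _ ≤ ‖v b₂‖ * W := pl b₂
      _ ≤ Pv * W := mul_le_mul_of_nonneg_right hvb hW0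
  -- the target bound dominates each case bound
  set K := 3 * Pu ^ 2 / |σ| + 3 * Pv ^ 2 / |ω| + 3 * (Pu * Pv) / (2 * Real.sqrt (ω * σ)) +
    2 * (b₂ - b₁) with hK
  have hT1 : 0 ≤ Pu ^ 2 / |σ| := by positivity
  have hT2 : 0 ≤ Pv ^ 2 / |ω| := by positivity
  have hT3 : 0 ≤ Pu * Pv / (2 * Real.sqrt (ω * σ)) := by positivity
  have hT4 : 0 ≤ b₂ - b₁ := sub_nonneg.2 hb
  -- `Pu Pv ≤ W · PuPv/(2√(ωσ))` (Wronskian floor)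
  have hcross : Pu * Pv ≤ W * (Pu * Pv / (2 * Real.sqrt (ω * σ))) := by
    have h1 : 1 ≤ W / (2 * Real.sqrt (ω * σ)) := (one_le_div (by positivity)).2 hfloor
    calc Pu * Pv = Pu * Pv * 1 := (mul_one _).symm
      _ ≤ Pu * Pv * (W / (2 * Real.sqrt (ω * σ))) :=
          mul_le_mul_of_nonneg_left h1 (mul_nonneg hPu0 hPv0)
      _ = W * (Pu * Pv / (2 * Real.sqrt (ω * σ))) := by ring
  -- CASE ANALYSIS on the positions of `x ≤ x'` relative to `b₁ ≤ b₂`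
  have main : ‖u x‖ * ‖v x'‖ ≤ W * (Pu ^ 2 / |σ|) + W * (Pv ^ 2 / |ω|) +
      W * (Pu * Pv / (2 * Real.sqrt (ω * σ))) +
      W * (2 * (Pu ^ 2 / |σ| + Pv ^ 2 / |ω| + (b₂ - b₁) + Pu * Pv / (2 * Real.sqrt (ω * σ)))) := by
    have hA : 0 ≤ W * (Pu ^ 2 / |σ|) := by positivity
    have hB : 0 ≤ W * (Pv ^ 2 / |ω|) := by positivity
    have hC : 0 ≤ W * (Pu * Pv / (2 * Real.sqrt (ω * σ))) := by positivity
    have hD : 0 ≤ W * (2 * (Pu ^ 2 / |σ| + Pv ^ 2 / |ω| + (b₂ - b₁) +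
        Pu * Pv / (2 * Real.sqrt (ω * σ)))) := by positivity
    rcases le_or_gt x' b₁ with hx'b₁ | hx'b₁
    · -- Case A: both points left of the barrier (pairing at `x'`)
      have h1 : ‖u x‖ ≤ Pu := hPu x (hxx'.trans hx'b₁)
      have h2 : ‖u x'‖ ≤ Pu := hPu x' hx'b₁
      have h3 : |σ| * ‖v x'‖ ≤ ‖u x'‖ * W := pr x'
      have : ‖u x‖ * ‖v x'‖ ≤ W * (Pu ^ 2 / |σ|) := by
        rw [mul_div_assoc', le_div_iff₀ hσ']
        calc ‖u x‖ * ‖v x'‖ * |σ| = ‖u x‖ * (|σ| * ‖v x'‖) := by ring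
          _ ≤ Pu * (‖u x'‖ * W) := mul_le_mul h1 h3 (by positivity) hPu0
          _ ≤ Pu * (Pu * W) := by gcongr
          _ = W * Pu ^ 2 := by ring
      linarith
    rcases le_or_gt b₂ x with hb₂x | hb₂x
    · -- Case B: both points right of the barrier (pairing at `x`)
      have h1 : ‖v x‖ ≤ Pv := hPv x hb₂x
      have h2 : ‖v x'‖ ≤ Pv := hPv x' (hb₂x.trans hxx')
      have h3 : |ω| * ‖u x‖ ≤ ‖v x‖ * W := pl x
      have : ‖u x‖ * ‖v x'‖ ≤ W * (Pv ^ 2 / |ω|) := by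
        rw [mul_div_assoc', le_div_iff₀ hω']
        calc ‖u x‖ * ‖v x'‖ * |ω| = (|ω| * ‖u x‖) * ‖v x'‖ := by ring
          _ ≤ (‖v x‖ * W) * Pv := mul_le_mul h3 h2 (norm_nonneg _) (by positivity)
          _ ≤ (Pv * W) * Pv := by gcongr
          _ = W * Pv ^ 2 := by ring
      linarith
    -- now `x < b₂` and `b₁ < x'`
    rcases lt_or_ge x b₁ with hxb₁ | hxb₁
    · have h1 : ‖u x‖ ≤ Pu := hPu x hxb₁.le
      rcases lt_or_ge b₂ x' with hb₂x' | hb₂x'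
      · -- Case C: `x` left, `x'` right
        have h2 : ‖v x'‖ ≤ Pv := hPv x' hb₂x'.le
        have : ‖u x‖ * ‖v x'‖ ≤ Pu * Pv := mul_le_mul h1 h2 (norm_nonneg _) hPu0
        linarith [hcross]
      · -- Case D: `x` left, `x'` inside the barrier: convexity of `‖v‖²`
        have hx'I : x' ∈ Icc b₁ b₂ := ⟨hx'b₁.le, hb₂x'⟩
        have hcvx := norm_sq_le_max_of_nonneg hv' hq hx'I
        have h2 : ‖v x'‖ ≤ Pv + Pu * W / |σ| := by
          have h0 : 0 ≤ Pu * W / |σ| := by positivity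
          have hm : ‖v x'‖ ^ 2 ≤ (Pv + Pu * W / |σ|) ^ 2 := by
            refine hcvx.trans (max_le ?_ ?_)
            · exact pow_le_pow_left₀ (norm_nonneg _) (hvb₁.trans (le_add_of_nonneg_left hPv0)) 2
            · exact pow_le_pow_left₀ (norm_nonneg _) (hvb.trans (le_add_of_nonneg_right h0)) 2
          exact (pow_le_pow_iff_left₀ (norm_nonneg _) (by positivity) two_ne_zero).1 hm
        have : ‖u x‖ * ‖v x'‖ ≤ Pu * Pv + W * (Pu ^ 2 / |σ|) := by
          calc ‖u x‖ * ‖v x'‖ ≤ Pu * (Pv + Pu * W / |σ|) :=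
                mul_le_mul h1 h2 (norm_nonneg _) hPu0
            _ = Pu * Pv + W * (Pu ^ 2 / |σ|) := by ring
        linarith [hcross]
    · -- `x ∈ [b₁, b₂)`
      have hxI : x ∈ Icc b₁ b₂ := ⟨hxb₁, hb₂x.le⟩
      rcases lt_or_ge b₂ x' with hb₂x' | hb₂x'
      · -- Case E: `x` inside, `x'` right: convexity of `‖u‖²`
        have h2 : ‖v x'‖ ≤ Pv := hPv x' hb₂x'.le
        have hcvx := norm_sq_le_max_of_nonneg hu' hq hxI
        have h1 : ‖u x‖ ≤ Pu + Pv * W / |ω| := by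
          have h0 : 0 ≤ Pv * W / |ω| := by positivity
          have hm : ‖u x‖ ^ 2 ≤ (Pu + Pv * W / |ω|) ^ 2 := by
            refine hcvx.trans (max_le ?_ ?_)
            · exact pow_le_pow_left₀ (norm_nonneg _) (hub.trans (le_add_of_nonneg_right h0)) 2
            · exact pow_le_pow_left₀ (norm_nonneg _) (hub₂.trans (le_add_of_nonneg_left hPu0)) 2
          exact (pow_le_pow_iff_left₀ (norm_nonneg _) (by positivity) two_ne_zero).1 hm
        have : ‖u x‖ * ‖v x'‖ ≤ Pu * Pv + W * (Pv ^ 2 / |ω|) := by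
          calc ‖u x‖ * ‖v x'‖ ≤ (Pu + Pv * W / |ω|) * Pv :=
                mul_le_mul h1 h2 (norm_nonneg _) (by positivity)
            _ = Pu * Pv + W * (Pv ^ 2 / |ω|) := by ring
        linarith [hcross]
      · -- Case F: both inside: `barrier_product_bound` with `A = W²/σ²`, `B = W²/ω²`
        have hx'I : x' ∈ Icc b₁ b₂ := ⟨hx'b₁.le, hb₂x'⟩
        have hA : ∀ s ∈ Icc b₁ b₂, ‖v s‖ ^ 2 ≤ W ^ 2 / σ ^ 2 * ‖u s‖ ^ 2 := fun s _ ↦ by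
          have := norm_sq_le_of_pairing_right' (hfu s) (hfv s) h; rwa [hWs s] at this
        have hB : ∀ s ∈ Icc b₁ b₂, ‖u s‖ ^ 2 ≤ W ^ 2 / ω ^ 2 * ‖v s‖ ^ 2 := fun s _ ↦ by
          have := norm_sq_le_of_pairing_left' (hfu s) (hfv s) h; rwa [hWs s] at this
        have key := barrier_product_bound hu' hv' hq (by positivity) (by positivity) hA hB hxI hx'I hxx'
        rw [hWs b₁] at key
        have hsA : Real.sqrt (W ^ 2 / σ ^ 2) = W / |σ| := by
          rw [Real.sqrt_div' _ (sq_nonneg σ), Real.sqrt_sq hW0, Real.sqrt_sq_eq_abs]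
        have hsB : Real.sqrt (W ^ 2 / ω ^ 2) = W / |ω| := by
          rw [Real.sqrt_div' _ (sq_nonneg ω), Real.sqrt_sq hW0, Real.sqrt_sq_eq_abs]
        rw [hsA, hsB] at key
        have e1 : W / |σ| * ‖u b₁‖ ^ 2 ≤ W * (Pu ^ 2 / |σ|) := by
          calc W / |σ| * ‖u b₁‖ ^ 2 ≤ W / |σ| * Pu ^ 2 :=
                mul_le_mul_of_nonneg_left (pow_le_pow_left₀ (norm_nonneg _) hub 2)
                  (div_nonneg hW0 hσ'.le)
            _ = W * (Pu ^ 2 / |σ|) := by ring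
        have e2 : W / |ω| * ‖v b₂‖ ^ 2 ≤ W * (Pv ^ 2 / |ω|) := by
          calc W / |ω| * ‖v b₂‖ ^ 2 ≤ W / |ω| * Pv ^ 2 :=
                mul_le_mul_of_nonneg_left (pow_le_pow_left₀ (norm_nonneg _) hvb 2)
                  (div_nonneg hW0 hω'.le)
            _ = W * (Pv ^ 2 / |ω|) := by ring
        have e3 : ‖u b₁‖ * ‖v b₂‖ ≤ W * (Pu * Pv / (2 * Real.sqrt (ω * σ))) :=
          (mul_le_mul hub hvb (norm_nonneg _) hPu0).trans hcross
        have key' : ‖u x‖ * ‖v x'‖ ≤ 2 * (W * (Pu ^ 2 / |σ|) + W * (Pv ^ 2 / |ω|) +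
            W * (b₂ - b₁) + W * (Pu * Pv / (2 * Real.sqrt (ω * σ)))) := by
          refine key.trans (mul_le_mul_of_nonneg_left ?_ (by norm_num))
          refine add_le_add (add_le_add (add_le_add e1 e2) (le_of_eq (mul_comm _ _))) e3
        have expand : W * (2 * (Pu ^ 2 / |σ| + Pv ^ 2 / |ω| + (b₂ - b₁) +
            Pu * Pv / (2 * Real.sqrt (ω * σ)))) = 2 * (W * (Pu ^ 2 / |σ|) + W * (Pv ^ 2 / |ω|) +
            W * (b₂ - b₁) + W * (Pu * Pv / (2 * Real.sqrt (ω * σ)))) := by ring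
        rw [expand]
        linarith [key']
  calc ‖u x‖ * ‖v x'‖ ≤ _ := main
    _ = W * K := by rw [hK]; ring

end TwoPoint

end Literature.Analysis.ODE

end
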